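import Summits.QuantumFields.BalabanUV.T4Continuum.Support.NE7EtaClosenessFromCovRoot

/-!
# NE7EtaCurlFromCovGradient — route #1 of the NE7 crux, hardest stub S1∕L7b-background: THE DRESSED CURL IS A DIFFERENCE OF TWO
# COVARIANT GRADIENTS (exact identity, end-point convention), so the (Lip₂ᶜ) conjunct of INTERFACE REQUEST NE7→NE3 amendment 3 is
# REDUNDANT — the consumer-side END from T-E_w + (Lip₁ᶜ) + (Lip₂′ᶜ) alone

Cell `pub-balaban`, rung (B)+1 sub-cell t4, lineage `b2b-balaban-t4-ne7-p1`, generation 23 (CRUX PROVER NE7 #1, ruling e34b3e0c); crux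
skeleton `t4/skeletons/NE7-CRUX-R1.md` v1.7 §3quater; sequel of `NE7EtaRatesD4Cov` (p252735), `NE7EtaClosenessFromCovRoot` (p253945).
HONEST FRAMING (page 1): FIXED FINITE T⁴, rung (B)+1; NE7, NE3 NOT PRINTED in [Balaban1984PropagatorsI]–[Balaban1989LargeFieldII] and NOT
PROVED here; continuum YM on T⁴ ⇐ BetaPertH ∧ nine spine estimates (0/9 proved); BetaPertH ⇐ (D1) ∧ (D4) ∧ CAP+tail; G-an2-4 gates asym,
D1 and NE2/3/4; NOT infinite volume, NOT mass gap, NOT Clay.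

LOCATED (gen 23).  With the tree's placement convention of the dressed curl (`T4AveragingDeficitWall.curlAt`:
`Ad_{V₁} ψ₁ + Ad_{V₁V₂} ψ₂ − Ad_{V₁V₂} ψ₃ − Ad_{V₁V₂V₃⁻¹} ψ₄`, `V₁ = V z μ`, `V₂ = V (z+e_μ) ν`, `V₃ = V (z+e_ν) μ`) and the END-point
transport of the covariant gradient of amendment 3 (`D_μ Z_κ (x) := Ad (W (x + e κ) μ) (Z (x + e μ) κ) − Z x κ`, (Lip₁ᶜ)'s quantity),
  **`curlAt W Z z μ ν = Ad_{V₁V₂V₃⁻¹} (D_μ Z_ν (z)) − Ad_{V₁} (D_ν Z_μ (z))`  EXACTLY** (`curlAt_eq_covDiff`, any `d`, any `V`, pure algebra)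
— no small-field correction, no convention defect.  Hence for unitary `W`: `‖d_W Z (z; μ,ν)‖ ≤ ‖D_μ Z_ν (z)‖ + ‖D_ν Z_μ (z)‖`
(`norm_curlAt_le_covDiff`) and `sup ‖d_W Z‖ ≤ 2 · sup ‖D Z‖` (`norm_curl_le_two_mul_of_covDiff`).

CONSEQUENCE FOR THE ASK.  In `NE7EtaRatesD4Cov` ∕ `NE7EtaClosenessFromCovRoot` the curl coordinate (C) and the plaquette coordinate (Q)
were fed by (Lip₂ᶜ) `‖Ad (W x ρ) (d_W Z)(x + e ρ, π) − (d_W Z)(x, π)‖ ≤ Λ₂ξ³` (ℓ² → sup interpolation of the curl).  They now follow from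
the covariant GRADIENT rate (Gᶜ) `≤ 4l₁√(2γΛ₂′)·θ^{13k}` (`NE7EtaRatesD4Cov.norm_covDiff_le_rate`: energy + (Lip₁ᶜ) + (Lip₂′ᶜ)), at rate
`θ^{13k}` instead of `θ^{14k}` — still GEOMETRIC against the plaquette margin `ξ² = θ^{12k}` (ratio `θ^k`, `θ = L^{−1∕6}`):
  `norm_curl_le_rate_of_covDiff`    `‖d_W Z (x, π)‖ ≤ 8l₁√(2γΛ₂′)·θ^{13k}`,
  `norm_hol_sub_le_rate_of_covDiff` `‖(W e^Z)(∂p) − W(∂p)‖ ≤ (8l₁√(2γΛ₂′) + 1536l₁⁴γ²e^{8l₁²γ})·θ^{13k}`,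
and **`closeness_of_covRoot₂`** = THE CONSUMER-SIDE END from the covariant root WITHOUT (Lip₂ᶜ) (eight conjuncts inside the ∃(u, Z):
unitary∕periodic `u`, skew∕periodic `Z`, representation, energy, (Lip₁ᶜ) `Λ₁`, (Lip₂′ᶜ) `Λ₂′`), one fit `γ(θ^k)² ≤ l₁N`, no `Λ₂`, no `l₂`:
(P) `θ^{8k}`, (Gᶜ) `θ^{13k}`, (C) `θ^{13k}`, (Q) `θ^{13k}`.  `covRoot₂_of_covRoot₃`: amendment 3's nine-conjunct wording implies the
eight-conjunct one (projection), so a delivery in either wording feeds.  ⇒ INTERFACE REQUEST NE7→NE3 AMENDMENT 4: the ask is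
T-E_w + (Lip₁ᶜ) + (Lip₂′ᶜ); (Lip₂ᶜ) is WITHDRAWN.
HONEST.  One exact identity + bookkeeping over landed modules ([folklore]); the root is a HYPOTHESIS (row NE3's unseated estimate);
nothing of NE3∕NE7 discharged; NODE O untouched; 0 def; 0 sorry; nothing printed is a hypothesis of a theorem.
-/

set_option autoImplicit false

open scoped BigOperators Matrix Matrix.Norms.L2Operator
open Finset

namespace Summit.QuantumFields.BalabanUV.T4Continuum.NE7EtaCurlFromCovGradient

open Literature.MathematicalPhysics.QuantumFieldTheory.Balaban1983to89
open B7Prop1Explicit B7Prop2Explicit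
open T4AveragingDeficitWall hiding Site Plane Plaq Bond
open T4AveragingDeficitWallBoundary (periodBox IsPeriodicCfg)
open AveragingDeficitPeriodicCounting (IsPeriodicDir)
open T4AveragingDeficitNonAbelian (Ad_mul Ad_sub)
open AveragingDeficitTransport (norm_Ad_of_unitary)
open AveragingDeficitNearIdentity (Ad_one)
open MinimalActionSandwich (IsMinimiser)
open MinimalActionRate (Regular)
open NE3EnergyShapes (residualScale IsUnitarySite IsPeriodicSite)
open NE3EnergyWeightedShapes (energyNormW)
open NE3HessContinuity (bondL1At bondL1At_nonneg)
open NE3EnergySmallFieldCurl (norm_hol_vary_sub_hol_le_curl)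
open AveragingDeficitDualResidual (dualC1 dualC2)
open AveragingDeficitDerivWallProof (wallConst)
open NE7EtaRatesD4 (scale_le_half energy_budget_of_residualScale exists_fit_threshold)
open NE7EtaRatesD4Cov (norm_dir_le_rate_cov norm_covDiff_le_rate)
open NE7EtaRatesD4CovReg (unitary_periodic_rescale_bavg_of_regular)

noncomputable section

variable {d : ℕ} {n : Type*} [Fintype n] [DecidableEq n]

/-! ## §1 The identity: the dressed curl is a difference of two transported covariant gradients -/

/-- `Ad_{u⁻¹} ∘ Ad_u = id`. [folklore] -/
private theorem Ad_inv_Ad' (u : (Matrix n n ℂ)ˣ) (X : Matrix n n ℂ) : Ad u⁻¹ (Ad u X) = X := by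
  rw [← Ad_mul, inv_mul_cancel, Ad_one]

/-- **THE DRESSED CURL IS A DIFFERENCE OF TWO COVARIANT GRADIENTS (end-point transport), EXACTLY**: for every configuration `V`, direction
`ψ`, site `z` and directions `μ, ν`,
`curlAt V ψ z μ ν = Ad_{V₁V₂V₃⁻¹} (Ad (V (z + e ν) μ) (ψ (z + e μ) ν) − ψ z ν) − Ad_{V₁} (Ad (V (z + e μ) ν) (ψ (z + e ν) μ) − ψ z μ)`,
`V₁ = V z μ`, `V₂ = V (z + e μ) ν`, `V₃ = V (z + e ν) μ` — the two brackets are the (Lip₁ᶜ)∕(1.13) covariant gradients `D_μ ψ_ν (z)` and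
`D_ν ψ_μ (z)`. [folklore] -/
theorem curlAt_eq_covDiff (V : Site d → Fin d → (Matrix n n ℂ)ˣ) (ψ : Site d → Fin d → Matrix n n ℂ) (z : Site d) (μ ν : Fin d) :
    curlAt V ψ z μ ν
      = Ad (V z μ * V (z + e μ) ν * (V (z + e ν) μ)⁻¹) (Ad (V (z + e ν) μ) (ψ (z + e μ) ν) - ψ z ν)
        - Ad (V z μ) (Ad (V (z + e μ) ν) (ψ (z + e ν) μ) - ψ z μ) := by
  unfold curlAt
  simp only [Ad_mul, Ad_sub, Ad_inv_Ad']
  abel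

/-- **NORM FORM** (unitary `V`): `‖d_V ψ (z; μ, ν)‖ ≤ ‖D_μ ψ_ν (z)‖ + ‖D_ν ψ_μ (z)‖`. [folklore] -/
theorem norm_curlAt_le_covDiff {V : Site d → Fin d → (Matrix n n ℂ)ˣ} (hV : IsUnitaryCfg V) (ψ : Site d → Fin d → Matrix n n ℂ)
    (z : Site d) (μ ν : Fin d) :
    ‖curlAt V ψ z μ ν‖
      ≤ ‖Ad (V (z + e ν) μ) (ψ (z + e μ) ν) - ψ z ν‖ + ‖Ad (V (z + e μ) ν) (ψ (z + e ν) μ) - ψ z μ‖ := by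
  rw [curlAt_eq_covDiff]
  have hu : V z μ * V (z + e μ) ν * (V (z + e ν) μ)⁻¹ ∈ unitaryUnits (Matrix n n ℂ) :=
    (unitaryUnits _).mul_mem ((unitaryUnits _).mul_mem (hV _ _) (hV _ _)) ((unitaryUnits _).inv_mem (hV _ _))
  refine (norm_sub_le _ _).trans (le_of_eq ?_)
  rw [norm_Ad_of_unitary hu, norm_Ad_of_unitary (hV z μ)]

/-- **SUP FORM**: a uniform bound `G` on the covariant gradients (the (Lip₁ᶜ)∕(Gᶜ) quantity, every component `κ`, site `x`, direction `μ`)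
bounds every dressed curl by `2G` (unitary `W`). [folklore] -/
theorem norm_curl_le_two_mul_of_covDiff {W : Site d → Fin d → (Matrix n n ℂ)ˣ} (hW : IsUnitaryCfg W)
    {Z : Site d → Fin d → Matrix n n ℂ} {G : ℝ}
    (hG : ∀ (κ : Fin d) (x : Site d) (μ : Fin d), ‖Ad (W (x + e κ) μ) (Z (x + e μ) κ) - Z x κ‖ ≤ G)
    (π : T4AveragingDeficitWall.Plane d) (x : Site d) : ‖curl W Z (x, π)‖ ≤ 2 * G := by
  show ‖curlAt W Z x π.1.1 π.1.2‖ ≤ 2 * G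
  have h := norm_curlAt_le_covDiff hW Z x π.1.1 π.1.2
  have h1 := hG π.1.2 x π.1.1
  have h2 := hG π.1.1 x π.1.2
  linarith

/-- The same for `curlAt` with explicit directions. [folklore] -/
theorem norm_curlAt_le_two_mul_of_covDiff {W : Site d → Fin d → (Matrix n n ℂ)ˣ} (hW : IsUnitaryCfg W)
    {Z : Site d → Fin d → Matrix n n ℂ} {G : ℝ}
    (hG : ∀ (κ : Fin d) (x : Site d) (μ : Fin d), ‖Ad (W (x + e κ) μ) (Z (x + e μ) κ) - Z x κ‖ ≤ G)
    (z : Site d) (μ ν : Fin d) : ‖curlAt W Z z μ ν‖ ≤ 2 * G := by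
  have h := norm_curlAt_le_covDiff hW Z z μ ν
  have h1 := hG ν z μ
  have h2 := hG μ z ν
  linarith

/-! ## §2 The curl and plaquette coordinates at `d = 4` from the covariant-gradient rate (no (Lip₂ᶜ)) -/

/-- **THE CURL COORDINATE FROM (Gᶜ)**: `d = 4`, `θ⁶ = L⁻¹`, one `N L^k`-periodic pair `(W, Z)`, `W` unitary, (E) `L^k·energyNormW ≤ γ³`,
(Lip₁ᶜ) `Λ₁ ≤ l₁³`, (Lip₂′ᶜ) `Λ₂′ > 0`, FIT `γ(θ^k)² ≤ l₁N` ⟹ `‖d_W Z (x, π)‖ ≤ 8l₁√(2γΛ₂′)·θ^{13k}` — twice `norm_covDiff_le_rate`, by §1;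
(Lip₂ᶜ) is not used. [folklore] -/
theorem norm_curl_le_rate_of_covDiff {L N k : ℕ} (hL : 2 ≤ L) (hN : 1 ≤ N) (hk : 1 ≤ k) {θ : ℝ} (hθ : 0 < θ)
    (hθ6 : θ ^ 6 = ((L : ℝ))⁻¹) {W : Site 4 → Fin 4 → (Matrix n n ℂ)ˣ} {Z : Site 4 → Fin 4 → Matrix n n ℂ}
    (hWu : IsUnitaryCfg W) (hWP : IsPeriodicCfg W ((N * L ^ k : ℕ) : ℤ)) (hZP : IsPeriodicDir Z ((N * L ^ k : ℕ) : ℤ))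
    {γ Λ₁ l₁ Λ₂' : ℝ} (hγ : 0 < γ) (hl₁ : 0 < l₁) (hΛl : Λ₁ ≤ l₁ ^ 3) (hΛ₂' : 0 < Λ₂')
    (hE : (L : ℝ) ^ k * energyNormW L k W Z (periodBox (d := 4) (N * L ^ k)) ≤ γ ^ 3)
    (hlipc : ∀ (κ : Fin 4) (x : Site 4) (μ : Fin 4), ‖Ad (W (x + e κ) μ) (Z (x + e μ) κ) - Z x κ‖ ≤ Λ₁ * (((L : ℝ)⁻¹) ^ k) ^ 2)
    (hlip2c : ∀ (κ μ : Fin 4) (y : Site 4),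
      ‖Ad (W (y + e κ) μ) (Ad (W (y + e κ + e μ) μ) (Z (y + (2 : ℕ) • e μ) κ) - Z (y + e μ) κ)
        - (Ad (W (y + e κ) μ) (Z (y + e μ) κ) - Z y κ)‖ ≤ Λ₂' * (((L : ℝ)⁻¹) ^ k) ^ 3)
    (hfit : γ * (θ ^ k) ^ 2 ≤ l₁ * N) (π : T4AveragingDeficitWall.Plane 4) (x : Site 4) :
    ‖curl W Z (x, π)‖ ≤ 8 * l₁ * Real.sqrt (2 * γ * Λ₂') * θ ^ (13 * k) := by
  have hG : ∀ (κ : Fin 4) (x : Site 4) (μ : Fin 4),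
      ‖Ad (W (x + e κ) μ) (Z (x + e μ) κ) - Z x κ‖ ≤ 4 * l₁ * Real.sqrt (2 * γ * Λ₂') * θ ^ (13 * k) :=
    fun κ x μ => norm_covDiff_le_rate hL hN hk hθ hθ6 hWu hWP hZP hγ hl₁ hΛl hΛ₂' hE hlipc hlip2c hfit x μ κ
  have h := norm_curl_le_two_mul_of_covDiff hWu hG π x
  linarith

/-- **THE PLAQUETTE COORDINATE FROM (Gᶜ) AND (P)** (`W` unitary, `Z` skew, same data): for every plaquette
`‖(W e^Z)(∂p) − W(∂p)‖ ≤ (8l₁√(2γΛ₂′) + 1536l₁⁴γ²e^{8l₁²γ})·θ^{13k}` — the NE3 crew's `norm_hol_vary_sub_hol_le_curl` with the curl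
bound of this file and the sup bound (P) `8l₁²γθ^{8k}` in the exponential; (Lip₂ᶜ) is not used. [folklore] -/
theorem norm_hol_sub_le_rate_of_covDiff [Nonempty n] {L N k : ℕ} (hL : 2 ≤ L) (hN : 1 ≤ N) (hk : 1 ≤ k) {θ : ℝ} (hθ : 0 < θ)
    (hθ6 : θ ^ 6 = ((L : ℝ))⁻¹) {W : Site 4 → Fin 4 → (Matrix n n ℂ)ˣ} {Z : Site 4 → Fin 4 → Matrix n n ℂ}
    (hWu : IsUnitaryCfg W) (hZs : IsSkewDir Z) (hWP : IsPeriodicCfg W ((N * L ^ k : ℕ) : ℤ))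
    (hZP : IsPeriodicDir Z ((N * L ^ k : ℕ) : ℤ)) {γ Λ₁ l₁ Λ₂' : ℝ} (hγ : 0 < γ) (hl₁ : 0 < l₁) (hΛl : Λ₁ ≤ l₁ ^ 3)
    (hΛ₂' : 0 < Λ₂')
    (hE : (L : ℝ) ^ k * energyNormW L k W Z (periodBox (d := 4) (N * L ^ k)) ≤ γ ^ 3)
    (hlipc : ∀ (κ : Fin 4) (x : Site 4) (μ : Fin 4), ‖Ad (W (x + e κ) μ) (Z (x + e μ) κ) - Z x κ‖ ≤ Λ₁ * (((L : ℝ)⁻¹) ^ k) ^ 2)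
    (hlip2c : ∀ (κ μ : Fin 4) (y : Site 4),
      ‖Ad (W (y + e κ) μ) (Ad (W (y + e κ + e μ) μ) (Z (y + (2 : ℕ) • e μ) κ) - Z (y + e μ) κ)
        - (Ad (W (y + e κ) μ) (Z (y + e μ) κ) - Z y κ)‖ ≤ Λ₂' * (((L : ℝ)⁻¹) ^ k) ^ 3)
    (hfit : γ * (θ ^ k) ^ 2 ≤ l₁ * N) (z : Site 4) (μ ν : Fin 4) :
    ‖((hol (vary W Z 1) z (plaqWord μ ν) : (Matrix n n ℂ)ˣ) : Matrix n n ℂ)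
        - ((hol W z (plaqWord μ ν) : (Matrix n n ℂ)ˣ) : Matrix n n ℂ)‖
      ≤ (8 * l₁ * Real.sqrt (2 * γ * Λ₂') + 1536 * l₁ ^ 4 * γ ^ 2 * Real.exp (8 * l₁ ^ 2 * γ)) * θ ^ (13 * k) := by
  obtain ⟨-, hs1⟩ := scale_le_half hL hθ hθ6 hk
  set s : ℝ := θ ^ k with hsdef
  have hs : 0 < s := pow_pos hθ k
  set α : ℝ := 8 * l₁ ^ 2 * γ * θ ^ (8 * k) with hαdef
  have hsup : ∀ x κ, ‖Z x κ‖ ≤ α := fun x κ =>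
    norm_dir_le_rate_cov hL hN hk hθ hθ6 hWu hWP hZP hγ hl₁ hΛl hE hlipc hfit x κ
  have hG : ∀ (κ : Fin 4) (x : Site 4) (μ : Fin 4),
      ‖Ad (W (x + e κ) μ) (Z (x + e μ) κ) - Z x κ‖ ≤ 4 * l₁ * Real.sqrt (2 * γ * Λ₂') * θ ^ (13 * k) :=
    fun κ x μ => norm_covDiff_le_rate hL hN hk hθ hθ6 hWu hWP hZP hγ hl₁ hΛl hΛ₂' hE hlipc hlip2c hfit x μ κ
  have hcurl : ‖curlAt W Z z μ ν‖ ≤ 8 * l₁ * Real.sqrt (2 * γ * Λ₂') * θ ^ (13 * k) := by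
    have h := norm_curlAt_le_two_mul_of_covDiff hWu hG z μ ν
    linarith
  have h0 := norm_hol_vary_sub_hol_le_curl hWu hZs hsup (t := (1 : ℝ)) zero_le_one z μ ν
  rw [one_mul, one_mul] at h0
  have e8 : θ ^ (8 * k) = s ^ 8 := by rw [hsdef, ← pow_mul, mul_comm k 8]
  have e13 : θ ^ (13 * k) = s ^ 13 := by rw [hsdef, ← pow_mul, mul_comm k 13]
  have hα0 : 0 ≤ α := by positivity
  have hαs : α = 8 * l₁ ^ 2 * γ * s ^ 8 := by rw [hαdef, e8]
  have hs8 : s ^ 8 ≤ 1 := pow_le_one₀ hs.le hs1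
  have hαle : α ≤ 8 * l₁ ^ 2 * γ := by
    rw [hαs]
    have : 8 * l₁ ^ 2 * γ * s ^ 8 ≤ 8 * l₁ ^ 2 * γ * 1 := mul_le_mul_of_nonneg_left hs8 (by positivity)
    linarith
  have hexp1 : Real.exp α - 1 ≤ α * Real.exp α := by
    have h := Real.add_one_le_exp (-α)
    have h1 : Real.exp α * Real.exp (-α) = 1 := by rw [← Real.exp_add, add_neg_cancel, Real.exp_zero]
    nlinarith [mul_le_mul_of_nonneg_left h (Real.exp_pos α).le, Real.exp_pos α]
  have hexp : Real.exp α - 1 ≤ α * Real.exp (8 * l₁ ^ 2 * γ) :=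
    hexp1.trans (mul_le_mul_of_nonneg_left (Real.exp_le_exp.mpr hαle) hα0)
  have hL1 : bondL1At Z z μ ν ≤ 4 * α := by
    unfold bondL1At
    have := hsup z μ; have := hsup (z + e μ) ν; have := hsup (z + e ν) μ; have := hsup z ν
    linarith
  have hL10 : 0 ≤ bondL1At Z z μ ν := bondL1At_nonneg Z z μ ν
  have h2 : 6 * (Real.exp α - 1) * bondL1At Z z μ ν ≤ 6 * (α * Real.exp (8 * l₁ ^ 2 * γ)) * (4 * α) :=
    mul_le_mul (mul_le_mul_of_nonneg_left hexp (by norm_num)) hL1 hL10 (by positivity)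
  have hs16 : s ^ 16 ≤ s ^ 13 := pow_le_pow_of_le_one hs.le hs1 (by norm_num)
  have h3 : 6 * (α * Real.exp (8 * l₁ ^ 2 * γ)) * (4 * α) ≤ 1536 * l₁ ^ 4 * γ ^ 2 * Real.exp (8 * l₁ ^ 2 * γ) * s ^ 13 := by
    rw [hαs]
    have e1 : 6 * (8 * l₁ ^ 2 * γ * s ^ 8 * Real.exp (8 * l₁ ^ 2 * γ)) * (4 * (8 * l₁ ^ 2 * γ * s ^ 8))
        = 1536 * l₁ ^ 4 * γ ^ 2 * Real.exp (8 * l₁ ^ 2 * γ) * s ^ 16 := by ring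
    rw [e1]
    exact mul_le_mul_of_nonneg_left hs16 (by positivity)
  calc ‖((hol (vary W Z 1) z (plaqWord μ ν) : (Matrix n n ℂ)ˣ) : Matrix n n ℂ)
          - ((hol W z (plaqWord μ ν) : (Matrix n n ℂ)ˣ) : Matrix n n ℂ)‖
        ≤ ‖curlAt W Z z μ ν‖ + 6 * (Real.exp α - 1) * bondL1At Z z μ ν := h0
    _ ≤ 8 * l₁ * Real.sqrt (2 * γ * Λ₂') * θ ^ (13 * k) + 1536 * l₁ ^ 4 * γ ^ 2 * Real.exp (8 * l₁ ^ 2 * γ) * s ^ 13 :=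
        add_le_add hcurl (h2.trans h3)
    _ = (8 * l₁ * Real.sqrt (2 * γ * Λ₂') + 1536 * l₁ ^ 4 * γ ^ 2 * Real.exp (8 * l₁ ^ 2 * γ)) * θ ^ (13 * k) := by
        rw [e13]; ring

/-! ## §3 The consumer-side END from the covariant root WITHOUT (Lip₂ᶜ) -/

/-- **THE CONSUMER-SIDE END OF THE BACKGROUND COORDINATE, FROM T-E_w + (Lip₁ᶜ) + (Lip₂′ᶜ) ONLY** (INTERFACE REQUEST NE7→NE3
amendment 4).  `d = 4`, `L ≥ 2`, `N ≥ 1`, `θ⁶ = L⁻¹`, class data `0 ≤ b`, `512·5·8·L²·b ≤ 1`, `0 ≤ g`, `0 ≤ C`; the hypothesis `h` =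
the covariant root with EIGHT conjuncts inside the ∃(u, Z) (unitary∕periodic `u`, skew∕periodic `Z`, representation
`gaugeAct u UA = vary W Z 1` (`W = rescale L (bavg L UB)`), energy `energyNormW ≤ C·residualScale`, (Lip₁ᶜ) `Λ₁`, (Lip₂′ᶜ) `Λ₂′`); budget
`γ > 0` with `C·ρ₄ ≤ γ³`; ONE cube root `l₁ > 0` with `Λ₁ ≤ l₁³`; `Λ₂′ > 0`.  THEN at every level `k ≥ 1` with the FIT `γ(θ^k)² ≤ l₁N`,
for every datum and minimiser pair: `∃ u Z` with the representation and
  (P) `‖Z x κ‖ ≤ 8l₁²γ·θ^{8k}`, (Gᶜ) `‖Ad (W (x+e_κ) μ) (Z (x+e_μ) κ) − Z x κ‖ ≤ 4l₁√(2γΛ₂′)·θ^{13k}`,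
  (C) `‖d_W Z (x, π)‖ ≤ 8l₁√(2γΛ₂′)·θ^{13k}`, (Q) `‖(gaugeAct u UA)(∂p) − W(∂p)‖ ≤ (8l₁√(2γΛ₂′) + 1536l₁⁴γ²e^{8l₁²γ})·θ^{13k}`.
[folklore] -/
theorem closeness_of_covRoot₂ [Nonempty n] {𝒞 : ℕ → Set (Site 4 → Fin 4 → (Matrix n n ℂ)ˣ)} {L N : ℕ} (hL : 2 ≤ L)
    (hN : 1 ≤ N) {θ : ℝ} (hθ : 0 < θ) (hθ6 : θ ^ 6 = ((L : ℝ))⁻¹) {b g C Λ₁ Λ₂' : ℝ} (hb : 0 ≤ b)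
    (hbs : 512 * (4 + 1) * (4 + 4) * (L : ℝ) ^ 2 * b ≤ 1) (hg : 0 ≤ g) (hC : 0 ≤ C) (hΛ₂' : 0 < Λ₂')
    {dom : Set (Site 4 → Fin 4 → (Matrix n n ℂ)ˣ)}
    (h : ∀ k : ℕ, 1 ≤ k → ∀ V ∈ dom, ∀ UA UB : Site 4 → Fin 4 → (Matrix n n ℂ)ˣ,
      IsMinimiser 4 𝒞 L N k V UA → IsMinimiser 4 𝒞 L N (k + 1) V UB → Regular 4 L N b g (k + 1) UB →
        ∃ (u : Site 4 → (Matrix n n ℂ)ˣ) (Z : Site 4 → Fin 4 → Matrix n n ℂ),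
          IsUnitarySite u ∧ IsPeriodicSite u ((N * L ^ k : ℕ) : ℤ) ∧
          IsSkewDir Z ∧ IsPeriodicDir Z ((N * L ^ k : ℕ) : ℤ) ∧
          gaugeAct u UA = vary (rescale L (bavg L UB)) Z 1 ∧
          energyNormW L k (rescale L (bavg L UB)) Z (periodBox (N * L ^ k)) ≤ C * residualScale 4 L N b g k ∧
          (∀ (κ : Fin 4) (x : Site 4) (μ : Fin 4),
            ‖Ad (rescale L (bavg L UB) (x + e κ) μ) (Z (x + e μ) κ) - Z x κ‖ ≤ Λ₁ * (((L : ℝ)⁻¹) ^ k) ^ 2) ∧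
          (∀ (κ μ : Fin 4) (y : Site 4),
            ‖Ad (rescale L (bavg L UB) (y + e κ) μ)
                (Ad (rescale L (bavg L UB) (y + e κ + e μ) μ) (Z (y + (2 : ℕ) • e μ) κ) - Z (y + e μ) κ)
              - (Ad (rescale L (bavg L UB) (y + e κ) μ) (Z (y + e μ) κ) - Z y κ)‖ ≤ Λ₂' * (((L : ℝ)⁻¹) ^ k) ^ 3))
    {γ l₁ : ℝ} (hγ : 0 < γ)
    (hγ3 : C * (wallConst 4 L * (N : ℝ) ^ 2 * (Real.sqrt g * dualC2 4 L + 2 * b ^ 2 * dualC1 4 L)) ≤ γ ^ 3)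
    (hl₁ : 0 < l₁) (hΛl₁ : Λ₁ ≤ l₁ ^ 3)
    {k : ℕ} (hk : 1 ≤ k) (hfit : γ * (θ ^ k) ^ 2 ≤ l₁ * N)
    {V : Site 4 → Fin 4 → (Matrix n n ℂ)ˣ} (hV : V ∈ dom) {UA UB : Site 4 → Fin 4 → (Matrix n n ℂ)ˣ}
    (hA : IsMinimiser 4 𝒞 L N k V UA) (hB : IsMinimiser 4 𝒞 L N (k + 1) V UB) (hreg : Regular 4 L N b g (k + 1) UB) :
    ∃ (u : Site 4 → (Matrix n n ℂ)ˣ) (Z : Site 4 → Fin 4 → Matrix n n ℂ),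
      IsUnitarySite u ∧ IsPeriodicSite u ((N * L ^ k : ℕ) : ℤ) ∧ IsSkewDir Z ∧ IsPeriodicDir Z ((N * L ^ k : ℕ) : ℤ) ∧
      gaugeAct u UA = vary (rescale L (bavg L UB)) Z 1 ∧
      (∀ (x : Site 4) (κ : Fin 4), ‖Z x κ‖ ≤ 8 * l₁ ^ 2 * γ * θ ^ (8 * k)) ∧
      (∀ (x : Site 4) (μ κ : Fin 4),
        ‖Ad (rescale L (bavg L UB) (x + e κ) μ) (Z (x + e μ) κ) - Z x κ‖ ≤ 4 * l₁ * Real.sqrt (2 * γ * Λ₂') * θ ^ (13 * k)) ∧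
      (∀ (π : T4AveragingDeficitWall.Plane 4) (x : Site 4),
        ‖curl (rescale L (bavg L UB)) Z (x, π)‖ ≤ 8 * l₁ * Real.sqrt (2 * γ * Λ₂') * θ ^ (13 * k)) ∧
      (∀ (z : Site 4) (μ ν : Fin 4),
        ‖((hol (gaugeAct u UA) z (plaqWord μ ν) : (Matrix n n ℂ)ˣ) : Matrix n n ℂ)
            - ((hol (rescale L (bavg L UB)) z (plaqWord μ ν) : (Matrix n n ℂ)ˣ) : Matrix n n ℂ)‖
          ≤ (8 * l₁ * Real.sqrt (2 * γ * Λ₂') + 1536 * l₁ ^ 4 * γ ^ 2 * Real.exp (8 * l₁ ^ 2 * γ)) * θ ^ (13 * k)) := by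
  obtain ⟨u, Z, hu, huP, hZ, hZP, hrep, hE, h1, h2⟩ := h k hk V hV UA UB hA hB hreg
  have hL1 : 1 ≤ L := by omega
  obtain ⟨hWu, hWP⟩ := unitary_periodic_rescale_bavg_of_regular hL1 hb hbs hreg
  have hEγ : (L : ℝ) ^ k * energyNormW L k (rescale L (bavg L UB)) Z (periodBox (d := 4) (N * L ^ k)) ≤ γ ^ 3 :=
    (energy_budget_of_residualScale hL1 N b hg hC k hE).trans hγ3
  refine ⟨u, Z, hu, huP, hZ, hZP, hrep, ?_, ?_, ?_, ?_⟩
  · exact fun x κ => norm_dir_le_rate_cov hL hN hk hθ hθ6 hWu hWP hZP hγ hl₁ hΛl₁ hEγ h1 hfit x κ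
  · exact fun x μ κ => norm_covDiff_le_rate hL hN hk hθ hθ6 hWu hWP hZP hγ hl₁ hΛl₁ hΛ₂' hEγ h1 h2 hfit x μ κ
  · exact fun π x => norm_curl_le_rate_of_covDiff hL hN hk hθ hθ6 hWu hWP hZP hγ hl₁ hΛl₁ hΛ₂' hEγ h1 h2 hfit π x
  · intro z μ ν
    rw [hrep]
    exact norm_hol_sub_le_rate_of_covDiff hL hN hk hθ hθ6 hWu hZ hWP hZP hγ hl₁ hΛl₁ hΛ₂' hEγ h1 h2 hfit z μ ν

/-- **AMENDMENT 3 ⇒ AMENDMENT 4** (projection): a delivery of the nine-conjunct covariant root of WAKE-1 amendment 3 (with (Lip₂ᶜ)) is a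
delivery of the eight-conjunct root consumed by `closeness_of_covRoot₂` — either wording feeds the END. [folklore] -/
theorem covRoot₂_of_covRoot₃ {𝒞 : ℕ → Set (Site 4 → Fin 4 → (Matrix n n ℂ)ˣ)} {L N : ℕ} {b g C Λ₁ Λ₂ Λ₂' : ℝ}
    {dom : Set (Site 4 → Fin 4 → (Matrix n n ℂ)ˣ)}
    (h : ∀ k : ℕ, 1 ≤ k → ∀ V ∈ dom, ∀ UA UB : Site 4 → Fin 4 → (Matrix n n ℂ)ˣ,
      IsMinimiser 4 𝒞 L N k V UA → IsMinimiser 4 𝒞 L N (k + 1) V UB → Regular 4 L N b g (k + 1) UB →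
        ∃ (u : Site 4 → (Matrix n n ℂ)ˣ) (Z : Site 4 → Fin 4 → Matrix n n ℂ),
          IsUnitarySite u ∧ IsPeriodicSite u ((N * L ^ k : ℕ) : ℤ) ∧
          IsSkewDir Z ∧ IsPeriodicDir Z ((N * L ^ k : ℕ) : ℤ) ∧
          gaugeAct u UA = vary (rescale L (bavg L UB)) Z 1 ∧
          energyNormW L k (rescale L (bavg L UB)) Z (periodBox (N * L ^ k)) ≤ C * residualScale 4 L N b g k ∧
          (∀ (κ : Fin 4) (x : Site 4) (μ : Fin 4),
            ‖Ad (rescale L (bavg L UB) (x + e κ) μ) (Z (x + e μ) κ) - Z x κ‖ ≤ Λ₁ * (((L : ℝ)⁻¹) ^ k) ^ 2) ∧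
          (∀ (κ μ : Fin 4) (y : Site 4),
            ‖Ad (rescale L (bavg L UB) (y + e κ) μ)
                (Ad (rescale L (bavg L UB) (y + e κ + e μ) μ) (Z (y + (2 : ℕ) • e μ) κ) - Z (y + e μ) κ)
              - (Ad (rescale L (bavg L UB) (y + e κ) μ) (Z (y + e μ) κ) - Z y κ)‖ ≤ Λ₂' * (((L : ℝ)⁻¹) ^ k) ^ 3) ∧
          (∀ (π : T4AveragingDeficitWall.Plane 4) (x : Site 4) (ρ : Fin 4),
            ‖Ad (rescale L (bavg L UB) x ρ) (curl (rescale L (bavg L UB)) Z (x + e ρ, π))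
              - curl (rescale L (bavg L UB)) Z (x, π)‖ ≤ Λ₂ * (((L : ℝ)⁻¹) ^ k) ^ 3)) :
    ∀ k : ℕ, 1 ≤ k → ∀ V ∈ dom, ∀ UA UB : Site 4 → Fin 4 → (Matrix n n ℂ)ˣ,
      IsMinimiser 4 𝒞 L N k V UA → IsMinimiser 4 𝒞 L N (k + 1) V UB → Regular 4 L N b g (k + 1) UB →
        ∃ (u : Site 4 → (Matrix n n ℂ)ˣ) (Z : Site 4 → Fin 4 → Matrix n n ℂ),
          IsUnitarySite u ∧ IsPeriodicSite u ((N * L ^ k : ℕ) : ℤ) ∧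
          IsSkewDir Z ∧ IsPeriodicDir Z ((N * L ^ k : ℕ) : ℤ) ∧
          gaugeAct u UA = vary (rescale L (bavg L UB)) Z 1 ∧
          energyNormW L k (rescale L (bavg L UB)) Z (periodBox (N * L ^ k)) ≤ C * residualScale 4 L N b g k ∧
          (∀ (κ : Fin 4) (x : Site 4) (μ : Fin 4),
            ‖Ad (rescale L (bavg L UB) (x + e κ) μ) (Z (x + e μ) κ) - Z x κ‖ ≤ Λ₁ * (((L : ℝ)⁻¹) ^ k) ^ 2) ∧
          (∀ (κ μ : Fin 4) (y : Site 4),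
            ‖Ad (rescale L (bavg L UB) (y + e κ) μ)
                (Ad (rescale L (bavg L UB) (y + e κ + e μ) μ) (Z (y + (2 : ℕ) • e μ) κ) - Z (y + e μ) κ)
              - (Ad (rescale L (bavg L UB) (y + e κ) μ) (Z (y + e μ) κ) - Z y κ)‖ ≤ Λ₂' * (((L : ℝ)⁻¹) ^ k) ^ 3) := by
  intro k hk V hV UA UB hA hB hreg
  obtain ⟨u, Z, hu, huP, hZ, hZP, hrep, hE, h1, h2, -⟩ := h k hk V hV UA UB hA hB hreg
  exact ⟨u, Z, hu, huP, hZ, hZP, hrep, hE, h1, h2⟩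

/-- **(Lip₁ᶜ) ALONE BOUNDS THE CURL** (no rate claimed): under (Lip₁ᶜ) with constant `Λ₁` at scale `ξ²`, every dressed curl of `Z` at a
unitary `W` is `≤ 2Λ₁ξ²` — the (Lip₂ᶜ)-free form of the remark that the regularity conjuncts are BOUNDEDNESS at the natural scale, the RATE
coming from the energy. [folklore] -/
theorem norm_curl_le_of_lip1c {L k : ℕ} {W : Site d → Fin d → (Matrix n n ℂ)ˣ} (hWu : IsUnitaryCfg W)
    {Z : Site d → Fin d → Matrix n n ℂ} {Λ₁ : ℝ}
    (hlipc : ∀ (κ : Fin d) (x : Site d) (μ : Fin d), ‖Ad (W (x + e κ) μ) (Z (x + e μ) κ) - Z x κ‖ ≤ Λ₁ * (((L : ℝ)⁻¹) ^ k) ^ 2)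
    (π : T4AveragingDeficitWall.Plane d) (x : Site d) : ‖curl W Z (x, π)‖ ≤ 2 * (Λ₁ * (((L : ℝ)⁻¹) ^ k) ^ 2) :=
  norm_curl_le_two_mul_of_covDiff hWu hlipc π x

end

end Summit.QuantumFields.BalabanUV.T4Continuum.NE7EtaCurlFromCovGradient
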